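/-
Copyright (c) 2026 the pub-hodgecm-mathlib formalisation cell (harness21).  Prover seat hodgecm-mathlib-K2E1-p16 (g4), Track B ∕ K2-LIT, h413 = `stmt-HodgeConjecture-24833`,
R90-TF section S8 «ContSpec-n½», ESTATE T ∕ (R)′ row `hEXP`, S8 dealer R90-CS-plan (g3) S8-R231 (1) = RULING J-S8-CO STEP (3) «THE PRODUCT REALISATION of
`K_∞ := ↥archMaximalCompact`», FILE A of two (400-line law): the archimedean maximal compact of record READ PLACE BY PLACE — unitary `J₃`-commuting components, joint
injectivity, the torus `M_∞ = K_∞ ∩ B(𝔸)` as `diag(u_w, β_w, u_w)` with PRODUCT surjectivity, the transpose partner, compactness.  FILE B `R90S8ArchMaximalCompactTransposeRealisationU3`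
runs Gelfand's trick on the product.
-/
import Summits.HodgeConjecture.HodgeConjecture.Theorems.R90S8ResGMidAtomTauU3Defs              -- ★ τ-DEFS (CS-typ2): `archMaximalCompact`, `mem_archMaximalCompact_iff`, `archToAdelic_mem_archMaximalCompact`
import Summits.HodgeConjecture.HodgeConjecture.Theorems.R90S8ChiSectionPairLevelOfRecordU3     -- ★ 3d (K2E1-p11): `evalC_map_mul_antidiagonal_eq`, `evalC_apply_centro`, `adelicVal_archToAdelic_archPart_mem`, `antidiagonal_three_over_apply`
import Literature.NumberTheory.Automorphic.UnitaryGroupArchimedeanPlaces                        -- ★ U2-vi: `archLocal`, `archPiEquiv`, `coe_archPiEquiv_symm_apply`, `mixedSpace_ext`, `isEmpty_isReal`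
import Literature.NumberTheory.Automorphic.UnitaryGroupBorelSemidirect                          -- ★ `isClosed_borelAdelic`; brings ★ `borelAdelic`, `mem_borelAdelic_iff`, `glDiagonal_mem_unitaryGroupOfForm_antidiagonal_iff`
import Literature.NumberTheory.Automorphic.AdelicGLnGlueProofs                                  -- ★ `isCompact_Kinf_holds`
import Literature.LinearAlgebra.Matrix.HouseholderQR                                            -- ★ `isDiag_of_blockTriangular_of_mem_unitaryGroup` (unitary upper-triangular ⇒ diagonal)
import HarnessLib

/-!
# R90-TF · S8 «ContSpec-n½» — `R90S8ArchMaximalCompactPlacewiseU3`: `K_∞ = ↥(archMaximalCompact L)` AND ITS TORUS `M_∞ = K_∞ ⊓ B(𝔸)` READ PLACE BY PLACE (J-S8-CO STEP (3), FILE A)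

Cell `hodgecm-mathlib`, crux H413 (`stmt-HodgeConjecture-24833`, lane `--supports … --as helper`), route of record `HCCMUnconditional`; R90-TF section S8, ESTATE T, RULING J-S8-CO
(S8-R231): K2E1-p12 (g6)'s letter `hCO` («the co-weight functionals on an irreducible `K_∞`-type form a LINE») is reached in four steps (2) Riesz bridge · **(3) this file + FILE B** · (4)
Hilbert packaging · (5) assembly.  THEOREMS ONLY (no `def`, no `instance`, no `notation`, no named-fact hypothesis, no `sorry`; default heartbeats); count-neutral; CLOSES NO SOCKET.

THE MATHEMATICS ([BorelJacquet1979] §1.1, §4.1 `G_∞ = ∏_{w∣∞} G(L_w)`, `K = K_∞·G(𝒪̂)`; [Rogawski1990] §1.9–§1.10; [HornJohnson2013] Lemma 2.1.10).  The archimedean maximal compact of record is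
`K_∞ = ι(U(J₃)(L ⊗ ℝ) ∩ K) ≤ G(𝔸)` (★ τ-DEFS `archMaximalCompact`); over the complex places `w` of the CM field `L` the Literature product decomposition ★ `archPiEquiv :
U(J₃)(L ⊗ ℝ) ≃ₜ* ∏_w U(σ_w J₃)(ℂ)` reads every `k ∈ K_∞` as the family of its components `(k_∞)_w ∈ U(3)`.  No single injective `K_∞ →* U(3)` exists; the family is JOINTLY injective,
and that is what FILE B's Gelfand trick needs.  This file supplies the place-wise inputs:
* `antidiagonal_three_over_complex_eq` (`J₃ ⊗ 1` over `ℂ` is ★ (α)'s `!![0,0,1;0,1,0;1,0,0]`); `archToAdelic_archPart_of_mem` (`k = ι(k_∞)` on `K_∞`);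
* per place: **`evalC_map_mem_unitaryGroup`** (`(k_∞)_w ∈ U(3)`, ★ `mem_Kinf_iff`), `evalC_map_mul_antidiagonal_eq'` (`(k_∞)_w J₃ = J₃ (k_∞)_w`, ★ `evalC_map_mul_antidiagonal_eq`), JOINT INJECTIVITY
  **`eq_of_forall_evalC_map_eq`** ∕ `eq_of_forall_evalC_map_archPart_eq` (★ `archPiEquiv`);
* on the torus: `evalC_map_blockTriangular_of_mem_borelAdelic` (`ι(a) ∈ B(𝔸) ⇒ a_w` upper triangular: ★ `mem_borelAdelic_iff` read through ★ `GLn.coe_ofInfinite_apply`), **`exists_evalC_map_eq_diagonal`**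
  (unitary + upper triangular ⇒ DIAGONAL ★ `isDiag_of_blockTriangular_of_mem_unitaryGroup`, and the centro-symmetry ★ `evalC_apply_centro` gives `diag(u_w, β_w, u_w)`, `|u_w| = |β_w| = 1`);
* `archToAdelic_mem_archMaximalCompact_of_forall_mem_unitaryGroup` (all components unitary ⇒ `ι(a) ∈ K_∞`; no real places ★ `isEmpty_isReal`, ★ `map_Kinf_le_standardMaximalCompactGL`);
* PRODUCT SURJECTIVITY **`exists_mem_inf_forall_evalC_map_eq_diagonal`** (`hjM`: every unit family `(u_w, β_w)_w` is ONE `m ∈ K_∞ ∩ B(𝔸)` — assemble `diag(u_w, β_w, u_w) ∈ U(σ_w J₃)(ℂ)` by ★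
  `glDiagonal_mem_unitaryGroupOfForm_antidiagonal_iff` and ★ `archPiEquiv.symm`; upper triangularity of `ι(m)` by ★ `mixedSpace_ext`);
* THE TRANSPOSE PARTNER **`exists_mem_forall_evalC_map_eq_transpose`** (`∀ k ∈ K_∞, ∃ k′ ∈ K_∞, (k′_∞)_w = ((k_∞)_w)ᵀ`: `gᵀ` is unitary, commutes with `J₃`, lies in `U(σ_w J₃)(ℂ)`);
* COMPACTNESS **`isCompact_archMaximalCompact`** (★ `isCompact_Kinf_holds`, ★ `isClosed_arch`, ★ `continuous_archToAdelic`) and **`isCompact_archMaximalCompact_inf_borelAdelic`** (★ `isClosed_borelAdelic`).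
HONEST LABEL: HC_CM is proved only modulo the 7 printed citations (2 remaining named inputs: hLiu418 = `stmt-HodgeConjecture-24832`, h413 = `stmt-HodgeConjecture-24833`) until rung 0
closes; REL ≠ ★ ≠ BUILT; this file asserts no named fact and closes no socket; `hCO` itself is NOT claimed here; count-neutral; unconditional.

## References
* [BorelJacquet1979] A. Borel, H. Jacquet, *Automorphic forms and automorphic representations*, Proc. Symp. Pure Math. 33.1 (1979), §1.1, §4.1 (`G_∞ = ∏_{w∣∞} G(L_w)`, `K = K_∞·G(𝒪̂)`).
* [Rogawski1990] J. D. Rogawski, *Automorphic Representations of Unitary Groups in Three Variables* (1990), §1.9–§1.10 (the maximal compact and the Borel pair of `U(3)`).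
* [HornJohnson2013] R. A. Horn, C. R. Johnson, *Matrix Analysis* (2nd ed., 2013), Lemma 2.1.10 (a unitary triangular matrix is diagonal).
* [Helgason2000] S. Helgason, *Groups and Geometric Analysis* (AMS 2000), Ch. IV §3, Thm. 3.1 (Gelfand's trick with an anti-automorphism — the consumer, FILE B).
-/

set_option autoImplicit false
set_option linter.dupNamespace false  -- the mandated namespace `…HodgeConjecture.HodgeConjecture.R90.S8` (LEAD #1 L1) repeats the summit's segment

noncomputable section

open Matrix NumberField NumberField.InfinitePlace Topology
open Literature.NumberTheory.Automorphic Literature.NumberTheory.Automorphic.UnitaryGroup Literature.NumberTheory.GaloisRepresentations AdelicGroupData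
open scoped ComplexConjugate

namespace Summit.HodgeConjecture.HodgeConjecture.R90.S8

/-! ## §1 `K_∞ = ↥(archMaximalCompact L)` read place by place: unitary `J₃`-commuting components, joint injectivity -/

section ArchMaximalCompact

variable (L : Type) [Field L] [NumberField L] [IsCMField L]

/-- `J₃ ⊗ 1` read over `ℂ` is the antidiagonal matrix `!![0, 0, 1; 0, 1, 0; 1, 0, 0]` of ★ (α). [cite: Rogawski1990, §1.9] -/
theorem antidiagonal_three_over_complex_eq : (StdForm.antidiagonal 3).over ℂ = !![(0 : ℂ), 0, 1; 0, 1, 0; 1, 0, 0] := by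
  ext i j
  fin_cases i <;> fin_cases j <;> simp [antidiagonal_three_over_apply, Fin.rev, Fin.ext_iff]

/-- On `K_∞`, `k = ι(k_∞)`: an element of `ι(K_∞)` IS the adelic image of its archimedean component (★ `archPart_archToAdelic`). [cite: BorelJacquet1979, §4.1] -/
theorem archToAdelic_archPart_of_mem {k : (quasiSplit (↥(maximalRealSubfield L)) L (IsCMField.complexConj L) 3).Adelic} (hk : k ∈ archMaximalCompact L) :
    archToAdelic (↥(maximalRealSubfield L)) L (IsCMField.complexConj L) 3 ((StdForm.antidiagonal 3).over L)
      (archPart (↥(maximalRealSubfield L)) L (IsCMField.complexConj L) 3 ((StdForm.antidiagonal 3).over L) k) = k := by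
  obtain ⟨-, a, rfl⟩ := (mem_archMaximalCompact_iff L k).1 hk
  rw [archPart_archToAdelic]

/-- **`(k_∞)_w ∈ U(3)`**: at every complex place the component of `k ∈ G_∞` with `ι(k) ∈ K` is a unitary matrix (★ `mem_Kinf_iff`, ★ `toMixed_mem_Kinf_of_mem_standardMaximalCompactGL`).
[cite: BorelJacquet1979, §1.1] -/
theorem evalC_map_mem_unitaryGroup (a : arch (↥(maximalRealSubfield L)) L (IsCMField.complexConj L) 3 ((StdForm.antidiagonal 3).over L))
    (hk : adelicVal (↥(maximalRealSubfield L)) L (IsCMField.complexConj L) 3 ((StdForm.antidiagonal 3).over L)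
      (archToAdelic (↥(maximalRealSubfield L)) L (IsCMField.complexConj L) 3 ((StdForm.antidiagonal 3).over L) a) ∈ standardMaximalCompactGL 3 L)
    (w : {w : InfinitePlace L // w.IsComplex}) :
    ((a : GL (Fin 3) (mixedEmbedding.mixedSpace L)) : Matrix (Fin 3) (Fin 3) (mixedEmbedding.mixedSpace L)).map (evalC L w) ∈ Matrix.unitaryGroup (Fin 3) ℂ := by
  set M : Matrix (Fin 3) (Fin 3) ℂ := ((a : GL (Fin 3) (mixedEmbedding.mixedSpace L)) : Matrix (Fin 3) (Fin 3) (mixedEmbedding.mixedSpace L)).map (evalC L w) with hM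
  have hKinf : (a : GL (Fin 3) (mixedEmbedding.mixedSpace L)) ∈ Kinf 3 L := by
    have h := toMixed_mem_Kinf_of_mem_standardMaximalCompactGL hk
    rwa [adelicVal_archToAdelic, GLn.toMixed_ofInfinite] at h
  have hU := ((mem_Kinf_iff 3 L _).1 hKinf).2 w
  rw [mem_unitarySubgroupGL_iff, Matrix.star_eq_conjTranspose] at hU
  change Mᴴ * M = 1 at hU
  exact Matrix.mem_unitaryGroup_iff'.2 (by rw [Matrix.star_eq_conjTranspose]; exact hU)

/-- **`(k_∞)_w J₃ = J₃ (k_∞)_w`** in ★ (α)'s spelling of `J₃` (★ `evalC_map_mul_antidiagonal_eq`). [cite: Rogawski1990, §1.9] -/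
theorem evalC_map_mul_antidiagonal_eq' (a : arch (↥(maximalRealSubfield L)) L (IsCMField.complexConj L) 3 ((StdForm.antidiagonal 3).over L))
    (hk : adelicVal (↥(maximalRealSubfield L)) L (IsCMField.complexConj L) 3 ((StdForm.antidiagonal 3).over L)
      (archToAdelic (↥(maximalRealSubfield L)) L (IsCMField.complexConj L) 3 ((StdForm.antidiagonal 3).over L) a) ∈ standardMaximalCompactGL 3 L)
    (w : {w : InfinitePlace L // w.IsComplex}) :
    ((a : GL (Fin 3) (mixedEmbedding.mixedSpace L)) : Matrix (Fin 3) (Fin 3) (mixedEmbedding.mixedSpace L)).map (evalC L w) * !![(0 : ℂ), 0, 1; 0, 1, 0; 1, 0, 0] =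
      !![(0 : ℂ), 0, 1; 0, 1, 0; 1, 0, 0] * ((a : GL (Fin 3) (mixedEmbedding.mixedSpace L)) : Matrix (Fin 3) (Fin 3) (mixedEmbedding.mixedSpace L)).map (evalC L w) := by
  have h := evalC_map_mul_antidiagonal_eq L a hk w.1
  rw [antidiagonal_three_over_complex_eq] at h
  exact h

/-- **JOINT INJECTIVITY of the place-wise realisation on `G_∞`**: an element of `U(J₃)(L ⊗ ℝ)` is determined by its components at the complex places (★ `archPiEquiv`).
[cite: BorelJacquet1979, §4.1] -/
theorem eq_of_forall_evalC_map_eq (a b : arch (↥(maximalRealSubfield L)) L (IsCMField.complexConj L) 3 ((StdForm.antidiagonal 3).over L))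
    (h : ∀ w : {w : InfinitePlace L // w.IsComplex},
      ((a : GL (Fin 3) (mixedEmbedding.mixedSpace L)) : Matrix (Fin 3) (Fin 3) (mixedEmbedding.mixedSpace L)).map (evalC L w) =
        ((b : GL (Fin 3) (mixedEmbedding.mixedSpace L)) : Matrix (Fin 3) (Fin 3) (mixedEmbedding.mixedSpace L)).map (evalC L w)) : a = b := by
  apply (archPiEquiv (↥(maximalRealSubfield L)) L (IsCMField.complexConj L) 3 ((StdForm.antidiagonal 3).over L) (IsCMField.complexConj_ne_one L)
    (UnitaryGroup.complexConj_smul_infinitePlace L)).injective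
  funext w
  exact Subtype.ext (Units.ext (h w))

/-- **JOINT INJECTIVITY on `K_∞`**: `k, k' ∈ ι(K_∞)` with the same components at every complex place are equal (`k = ι(k_∞)`). [cite: BorelJacquet1979, §4.1] -/
theorem eq_of_forall_evalC_map_archPart_eq (k k' : ↥(archMaximalCompact L))
    (h : ∀ w : {w : InfinitePlace L // w.IsComplex},
      (((archPart (↥(maximalRealSubfield L)) L (IsCMField.complexConj L) 3 ((StdForm.antidiagonal 3).over L)
          (k : (quasiSplit (↥(maximalRealSubfield L)) L (IsCMField.complexConj L) 3).Adelic) :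
          arch (↥(maximalRealSubfield L)) L (IsCMField.complexConj L) 3 ((StdForm.antidiagonal 3).over L)) : GL (Fin 3) (mixedEmbedding.mixedSpace L)) :
          Matrix (Fin 3) (Fin 3) (mixedEmbedding.mixedSpace L)).map (evalC L w) =
      (((archPart (↥(maximalRealSubfield L)) L (IsCMField.complexConj L) 3 ((StdForm.antidiagonal 3).over L)
          (k' : (quasiSplit (↥(maximalRealSubfield L)) L (IsCMField.complexConj L) 3).Adelic) :
          arch (↥(maximalRealSubfield L)) L (IsCMField.complexConj L) 3 ((StdForm.antidiagonal 3).over L)) : GL (Fin 3) (mixedEmbedding.mixedSpace L)) :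
          Matrix (Fin 3) (Fin 3) (mixedEmbedding.mixedSpace L)).map (evalC L w)) : k = k' := by
  have h1 := eq_of_forall_evalC_map_eq L _ _ h
  apply Subtype.ext
  rw [← archToAdelic_archPart_of_mem L k.2, ← archToAdelic_archPart_of_mem L k'.2, h1]

/-! ## §2 The torus `M_∞ = K_∞ ⊓ B(𝔸)`: `diag(u_w, β_w, u_w)`, product surjectivity, the transpose partner -/

/-- **`ι(a) ∈ B(𝔸) ⇒ a_w` is upper triangular** at every complex place (★ `mem_borelAdelic_iff` read through ★ `GLn.coe_ofInfinite_apply`: the `(i, j)` entry of `(a, 1)` is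
`(a_{ij}, δ_{ij})`). [cite: Rogawski1990, §1.9–§1.10] -/
theorem evalC_map_blockTriangular_of_mem_borelAdelic (a : arch (↥(maximalRealSubfield L)) L (IsCMField.complexConj L) 3 ((StdForm.antidiagonal 3).over L))
    (hB : archToAdelic (↥(maximalRealSubfield L)) L (IsCMField.complexConj L) 3 ((StdForm.antidiagonal 3).over L) a ∈
      borelAdelic (↥(maximalRealSubfield L)) L (IsCMField.complexConj L) 3) (w : {w : InfinitePlace L // w.IsComplex}) :
    (((a : GL (Fin 3) (mixedEmbedding.mixedSpace L)) : Matrix (Fin 3) (Fin 3) (mixedEmbedding.mixedSpace L)).map (evalC L w)).BlockTriangular id := by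
  intro i j hij
  have h := (mem_borelAdelic_iff _).1 hB hij
  rw [adelicVal_archToAdelic, GLn.coe_ofInfinite_apply] at h
  have h1 : (InfiniteAdeleRing.ringEquiv_mixedSpace L).symm (((a : GL (Fin 3) (mixedEmbedding.mixedSpace L)) : Matrix (Fin 3) (Fin 3) (mixedEmbedding.mixedSpace L)) i j) = 0 :=
    congrArg Prod.fst h
  have h2 : ((a : GL (Fin 3) (mixedEmbedding.mixedSpace L)) : Matrix (Fin 3) (Fin 3) (mixedEmbedding.mixedSpace L)) i j = 0 :=
    (map_eq_zero_iff _ (InfiniteAdeleRing.ringEquiv_mixedSpace L).symm.injective).1 h1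
  rw [Matrix.map_apply, h2, map_zero]

/-- `‖z‖ = 1` from `conj z · z = 1`. [folklore] -/
private theorem norm_eq_one_of_conj_mul_self_eq_one {z : ℂ} (h : conj z * z = 1) : ‖z‖ = 1 := by
  have h1 : ((‖z‖ ^ 2 : ℝ) : ℂ) = 1 := by rw [Complex.ofReal_pow, ← Complex.conj_mul', h]
  have h2 : ‖z‖ ^ 2 = 1 := by exact_mod_cast h1
  nlinarith [norm_nonneg z, h2]

/-- **THE TORUS SHAPE `diag(u_w, β_w, u_w)`**: for `a ∈ G_∞` with `ι(a) ∈ K ∩ B(𝔸)`, every component `a_w` is upper triangular (§2) and unitary, hence DIAGONAL (★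
`isDiag_of_blockTriangular_of_mem_unitaryGroup`), and the centro-symmetry `(a_w)₀₀ = (a_w)₂₂` (★ `evalC_apply_centro`) makes it `diag(u, β, u)` with `|u| = |β| = 1`.
[cite: Rogawski1990, §1.9–§1.10] [cite: HornJohnson2013, Lemma 2.1.10] -/
theorem exists_evalC_map_eq_diagonal (a : arch (↥(maximalRealSubfield L)) L (IsCMField.complexConj L) 3 ((StdForm.antidiagonal 3).over L))
    (hk : adelicVal (↥(maximalRealSubfield L)) L (IsCMField.complexConj L) 3 ((StdForm.antidiagonal 3).over L)
      (archToAdelic (↥(maximalRealSubfield L)) L (IsCMField.complexConj L) 3 ((StdForm.antidiagonal 3).over L) a) ∈ standardMaximalCompactGL 3 L)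
    (hB : archToAdelic (↥(maximalRealSubfield L)) L (IsCMField.complexConj L) 3 ((StdForm.antidiagonal 3).over L) a ∈
      borelAdelic (↥(maximalRealSubfield L)) L (IsCMField.complexConj L) 3) (w : {w : InfinitePlace L // w.IsComplex}) :
    ∃ u β : ℂ, ‖u‖ = 1 ∧ ‖β‖ = 1 ∧
      ((a : GL (Fin 3) (mixedEmbedding.mixedSpace L)) : Matrix (Fin 3) (Fin 3) (mixedEmbedding.mixedSpace L)).map (evalC L w) = Matrix.diagonal ![u, β, u] := by
  set M : Matrix (Fin 3) (Fin 3) ℂ := ((a : GL (Fin 3) (mixedEmbedding.mixedSpace L)) : Matrix (Fin 3) (Fin 3) (mixedEmbedding.mixedSpace L)).map (evalC L w) with hM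
  have hU := evalC_map_mem_unitaryGroup L a hk w
  have hD : M.IsDiag := Literature.LinearAlgebra.Matrix.HouseholderQR.isDiag_of_blockTriangular_of_mem_unitaryGroup hU (evalC_map_blockTriangular_of_mem_borelAdelic L a hB w)
  obtain ⟨-, -, h00⟩ := evalC_apply_centro L a hk w.1
  change M 0 0 = M 2 2 at h00
  have h10 : M 1 0 = 0 := hD (by decide)
  have h20 : M 2 0 = 0 := hD (by decide)
  have h01 : M 0 1 = 0 := hD (by decide)
  have h21 : M 2 1 = 0 := hD (by decide)
  have h02 : M 0 2 = 0 := hD (by decide)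
  have h12 : M 1 2 = 0 := hD (by decide)
  have hU' : star M * M = 1 := Matrix.mem_unitaryGroup_iff'.1 hU
  have hn0 : conj (M 0 0) * M 0 0 = 1 := by
    have h := congrFun (congrFun hU' 0) 0
    simpa [Matrix.mul_apply, Fin.sum_univ_three, h10, h20] using h
  have hn1 : conj (M 1 1) * M 1 1 = 1 := by
    have h := congrFun (congrFun hU' 1) 1
    simpa [Matrix.mul_apply, Fin.sum_univ_three, h01, h21] using h
  refine ⟨M 0 0, M 1 1, norm_eq_one_of_conj_mul_self_eq_one hn0, norm_eq_one_of_conj_mul_self_eq_one hn1, ?_⟩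
  ext i j
  fin_cases i <;> fin_cases j <;> simp [h10, h20, h01, h21, h02, h12, h00]

/-- `ι(a) ∈ ι(K_∞)` as soon as every component `a_w` is unitary (no real places: ★ `isEmpty_isReal`; ★ `mem_Kinf_iff`, ★ `map_Kinf_le_standardMaximalCompactGL`). [cite: BorelJacquet1979, §1.1, §4.1] -/
theorem archToAdelic_mem_archMaximalCompact_of_forall_mem_unitaryGroup (a : arch (↥(maximalRealSubfield L)) L (IsCMField.complexConj L) 3 ((StdForm.antidiagonal 3).over L))
    (h : ∀ w : {w : InfinitePlace L // w.IsComplex},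
      ((a : GL (Fin 3) (mixedEmbedding.mixedSpace L)) : Matrix (Fin 3) (Fin 3) (mixedEmbedding.mixedSpace L)).map (evalC L w) ∈ Matrix.unitaryGroup (Fin 3) ℂ) :
    archToAdelic (↥(maximalRealSubfield L)) L (IsCMField.complexConj L) 3 ((StdForm.antidiagonal 3).over L) a ∈ archMaximalCompact L := by
  refine archToAdelic_mem_archMaximalCompact L a ?_
  rw [adelicVal_archToAdelic]
  refine map_Kinf_le_standardMaximalCompactGL (Subgroup.mem_map_of_mem _ ((mem_Kinf_iff 3 L _).2 ⟨fun w => ?_, fun w => ?_⟩))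
  · exact ((isEmpty_isReal (↥(maximalRealSubfield L)) L (IsCMField.complexConj L) (IsCMField.complexConj_ne_one L) (UnitaryGroup.complexConj_smul_infinitePlace L)).false w).elim
  · exact (mem_unitarySubgroupGL_iff_coe_mem_unitaryGroup _).2 (h w)

/-- A diagonal matrix `diag(u, β, u)` with `|u| = |β| = 1` is unitary. [folklore] -/
private theorem diagonal_three_mem_unitaryGroup_of_norm_eq_one {u β : ℂ} (hu : ‖u‖ = 1) (hβ : ‖β‖ = 1) : Matrix.diagonal ![u, β, u] ∈ Matrix.unitaryGroup (Fin 3) ℂ := by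
  rw [Matrix.mem_unitaryGroup_iff', Matrix.star_eq_conjTranspose, Matrix.diagonal_conjTranspose, Matrix.diagonal_mul_diagonal, ← Matrix.diagonal_one,
    Matrix.diagonal_eq_diagonal_iff]
  have hu' : conj u * u = 1 := by rw [Complex.conj_mul', hu]; simp
  have hβ' : conj β * β = 1 := by rw [Complex.conj_mul', hβ]; simp
  intro i
  fin_cases i <;> simp [hu', hβ']

/-- **PRODUCT SURJECTIVITY `hjM`**: every family of unit pairs `(u_w, β_w)_w` over the complex places is realised by ONE `m ∈ ι(K_∞) ∩ B(𝔸)` with `(m_∞)_w = diag(u_w, β_w, u_w)` for all `w`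
— assemble `diag(u_w, β_w, u_w) ∈ U(σ_w J₃)(ℂ)` (★ `glDiagonal_mem_unitaryGroupOfForm_antidiagonal_iff`) by ★ `archPiEquiv.symm`; its adelic image is in `K` (all components unitary) and
upper triangular (★ `GLn.coe_ofInfinite_apply`, ★ `mixedSpace_ext`). [cite: BorelJacquet1979, §4.1] [cite: Rogawski1990, §1.9–§1.10] -/
theorem exists_mem_inf_forall_evalC_map_eq_diagonal (u β : {w : InfinitePlace L // w.IsComplex} → ℂ) (hu : ∀ w, ‖u w‖ = 1) (hβ : ∀ w, ‖β w‖ = 1) :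
    ∃ m : (quasiSplit (↥(maximalRealSubfield L)) L (IsCMField.complexConj L) 3).Adelic,
      m ∈ archMaximalCompact L ⊓ borelAdelic (↥(maximalRealSubfield L)) L (IsCMField.complexConj L) 3 ∧
      ∀ w : {w : InfinitePlace L // w.IsComplex},
        (((archPart (↥(maximalRealSubfield L)) L (IsCMField.complexConj L) 3 ((StdForm.antidiagonal 3).over L) m :
            arch (↥(maximalRealSubfield L)) L (IsCMField.complexConj L) 3 ((StdForm.antidiagonal 3).over L)) : GL (Fin 3) (mixedEmbedding.mixedSpace L)) :
            Matrix (Fin 3) (Fin 3) (mixedEmbedding.mixedSpace L)).map (evalC L w) = Matrix.diagonal ![u w, β w, u w] := by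
  have hu0 : ∀ w, u w ≠ 0 := fun w h0 => by have h1 := hu w; rw [h0, norm_zero] at h1; exact zero_ne_one h1
  have hβ0 : ∀ w, β w ≠ 0 := fun w h0 => by have h1 := hβ w; rw [h0, norm_zero] at h1; exact zero_ne_one h1
  have hu' : ∀ w, conj (u w) * u w = 1 := fun w => by rw [Complex.conj_mul', hu w]; simp
  have hβ' : ∀ w, conj (β w) * β w = 1 := fun w => by rw [Complex.conj_mul', hβ w]; simp
  -- the local diagonal elements `diag(u_w, β_w, u_w) ∈ U(σ_w J₃)(ℂ)`
  set d : ∀ w : {w : InfinitePlace L // w.IsComplex}, Fin 3 → ℂˣ := fun w => ![Units.mk0 (u w) (hu0 w), Units.mk0 (β w) (hβ0 w), Units.mk0 (u w) (hu0 w)] with hd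
  have hdval : ∀ w, (glDiagonal 3 ℂ (d w) : Matrix (Fin 3) (Fin 3) ℂ) = Matrix.diagonal ![u w, β w, u w] := fun w => by
    rw [coe_glDiagonal]
    congr 1
    funext k
    fin_cases k <;> rfl
  have hdmem : ∀ w, glDiagonal 3 ℂ (d w) ∈ archLocal L 3 ((StdForm.antidiagonal 3).over L) w := fun w => by
    change glDiagonal 3 ℂ (d w) ∈ unitaryGroupOfForm (starRingEnd ℂ) (((StdForm.antidiagonal 3).over L).map w.1.embedding)
    rw [StdForm.over_map]
    refine (glDiagonal_mem_unitaryGroupOfForm_antidiagonal_iff (starRingEnd ℂ) 3 (d w)).2 fun i => ?_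
    fin_cases i
    · exact hu' w
    · exact hβ' w
    · exact hu' w
  set a : arch (↥(maximalRealSubfield L)) L (IsCMField.complexConj L) 3 ((StdForm.antidiagonal 3).over L) :=
    (archPiEquiv (↥(maximalRealSubfield L)) L (IsCMField.complexConj L) 3 ((StdForm.antidiagonal 3).over L) (IsCMField.complexConj_ne_one L)
      (UnitaryGroup.complexConj_smul_infinitePlace L)).symm (fun w => ⟨glDiagonal 3 ℂ (d w), hdmem w⟩) with ha_def
  have ha : ∀ w : {w : InfinitePlace L // w.IsComplex},
      ((a : GL (Fin 3) (mixedEmbedding.mixedSpace L)) : Matrix (Fin 3) (Fin 3) (mixedEmbedding.mixedSpace L)).map (evalC L w) = Matrix.diagonal ![u w, β w, u w] := fun w => by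
    rw [← hdval w]
    ext i j
    rw [Matrix.map_apply, evalC_apply, ha_def, coe_archPiEquiv_symm_apply]
  refine ⟨archToAdelic (↥(maximalRealSubfield L)) L (IsCMField.complexConj L) 3 ((StdForm.antidiagonal 3).over L) a, Subgroup.mem_inf.2 ⟨?_, ?_⟩,
    fun w => by rw [archPart_archToAdelic]; exact ha w⟩
  · exact archToAdelic_mem_archMaximalCompact_of_forall_mem_unitaryGroup L a fun w => by rw [ha w]; exact diagonal_three_mem_unitaryGroup_of_norm_eq_one (hu w) (hβ w)
  · rw [mem_borelAdelic_iff]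
    intro i j hij
    have hij' : i ≠ j := fun h => (lt_irrefl _ (h ▸ hij : id i < id i))
    rw [adelicVal_archToAdelic, GLn.coe_ofInfinite_apply]
    have hzero : ((a : GL (Fin 3) (mixedEmbedding.mixedSpace L)) : Matrix (Fin 3) (Fin 3) (mixedEmbedding.mixedSpace L)) i j = 0 :=
      mixedSpace_ext (↥(maximalRealSubfield L)) L (IsCMField.complexConj L) (IsCMField.complexConj_ne_one L) (UnitaryGroup.complexConj_smul_infinitePlace L) fun w => by
        have h := congrFun (congrFun (ha w) i) j
        rw [Matrix.map_apply, evalC_apply] at h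
        rw [h, Matrix.diagonal_apply_ne _ hij']
        rfl
    refine Prod.ext ?_ ?_
    · rw [hzero, map_zero]; rfl
    · rw [Matrix.one_apply_ne hij']; rfl

/-- **THE TRANSPOSE PARTNER**: for `k ∈ ι(K_∞)` there is `k' ∈ ι(K_∞)` with `(k'_∞)_w = ((k_∞)_w)ᵀ` at every complex place — `gᵀ` is unitary (`(gᵀ)(gᵀ)ᴴ = (gᴴ g)ᵀ = 1`), lies in
`U(σ_w J₃)(ℂ)` (`(gᵀ)ᴴ J₃ gᵀ = (g J₃ gᴴ)ᵀ = (J₃ g gᴴ)ᵀ = J₃`, using `g J₃ = J₃ g` ★ and `J₃ᵀ = J₃`), and the family is assembled by ★ `archPiEquiv.symm`. [cite: Helgason2000, Ch. IV §3 Thm. 3.1]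
[cite: BorelJacquet1979, §4.1] -/
theorem exists_mem_forall_evalC_map_eq_transpose (k : ↥(archMaximalCompact L)) :
    ∃ k' : ↥(archMaximalCompact L), ∀ w : {w : InfinitePlace L // w.IsComplex},
      (((archPart (↥(maximalRealSubfield L)) L (IsCMField.complexConj L) 3 ((StdForm.antidiagonal 3).over L)
          (k' : (quasiSplit (↥(maximalRealSubfield L)) L (IsCMField.complexConj L) 3).Adelic) :
          arch (↥(maximalRealSubfield L)) L (IsCMField.complexConj L) 3 ((StdForm.antidiagonal 3).over L)) : GL (Fin 3) (mixedEmbedding.mixedSpace L)) :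
          Matrix (Fin 3) (Fin 3) (mixedEmbedding.mixedSpace L)).map (evalC L w) =
      ((((archPart (↥(maximalRealSubfield L)) L (IsCMField.complexConj L) 3 ((StdForm.antidiagonal 3).over L)
          (k : (quasiSplit (↥(maximalRealSubfield L)) L (IsCMField.complexConj L) 3).Adelic) :
          arch (↥(maximalRealSubfield L)) L (IsCMField.complexConj L) 3 ((StdForm.antidiagonal 3).over L)) : GL (Fin 3) (mixedEmbedding.mixedSpace L)) :
          Matrix (Fin 3) (Fin 3) (mixedEmbedding.mixedSpace L)).map (evalC L w))ᵀ := by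
  set a : arch (↥(maximalRealSubfield L)) L (IsCMField.complexConj L) 3 ((StdForm.antidiagonal 3).over L) :=
    archPart (↥(maximalRealSubfield L)) L (IsCMField.complexConj L) 3 ((StdForm.antidiagonal 3).over L)
      (k : (quasiSplit (↥(maximalRealSubfield L)) L (IsCMField.complexConj L) 3).Adelic) with ha_def
  have hk : adelicVal (↥(maximalRealSubfield L)) L (IsCMField.complexConj L) 3 ((StdForm.antidiagonal 3).over L)
      (archToAdelic (↥(maximalRealSubfield L)) L (IsCMField.complexConj L) 3 ((StdForm.antidiagonal 3).over L) a) ∈ standardMaximalCompactGL 3 L :=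
    adelicVal_archToAdelic_archPart_mem L k.2.1
  -- abbreviate the components
  set M : {w : InfinitePlace L // w.IsComplex} → Matrix (Fin 3) (Fin 3) ℂ := fun w =>
    ((a : GL (Fin 3) (mixedEmbedding.mixedSpace L)) : Matrix (Fin 3) (Fin 3) (mixedEmbedding.mixedSpace L)).map (evalC L w) with hM
  have hU : ∀ w, M w ∈ Matrix.unitaryGroup (Fin 3) ℂ := fun w => evalC_map_mem_unitaryGroup L a hk w
  have hUl : ∀ w, star (M w) * M w = 1 := fun w => Matrix.mem_unitaryGroup_iff'.1 (hU w)
  have hUr : ∀ w, M w * star (M w) = 1 := fun w => Matrix.mem_unitaryGroup_iff.1 (hU w)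
  have hJ : ∀ w, M w * (StdForm.antidiagonal 3).over ℂ = (StdForm.antidiagonal 3).over ℂ * M w := fun w => evalC_map_mul_antidiagonal_eq L a hk w.1
  -- `gᵀ` is unitary
  have hUT : ∀ w, (M w)ᵀ ∈ Matrix.unitaryGroup (Fin 3) ℂ := fun w => by
    rw [Matrix.mem_unitaryGroup_iff, Matrix.star_eq_conjTranspose, Matrix.conjTranspose_transpose_eq_transpose_conjTranspose, ← Matrix.transpose_mul,
      ← Matrix.star_eq_conjTranspose, hUl w, Matrix.transpose_one]
  -- `gᵀ ∈ U(σ_w J₃)(ℂ)`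
  have hLT : ∀ w, (Unitary.toUnits ⟨(M w)ᵀ, hUT w⟩ : GL (Fin 3) ℂ) ∈ archLocal L 3 ((StdForm.antidiagonal 3).over L) w := fun w => by
    rw [mem_archLocal_iff_conjTranspose, StdForm.over_map]
    change ((M w)ᵀ)ᴴ * (StdForm.antidiagonal 3).over ℂ * (M w)ᵀ = (StdForm.antidiagonal 3).over ℂ
    have h1 : ((M w)ᵀ)ᴴ * (StdForm.antidiagonal 3).over ℂ * (M w)ᵀ = (M w * (StdForm.antidiagonal 3).over ℂ * (M w)ᴴ)ᵀ := by
      rw [Matrix.transpose_mul, Matrix.transpose_mul, StdForm.transpose_over, Matrix.conjTranspose_transpose_eq_transpose_conjTranspose, Matrix.mul_assoc]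
    rw [h1, hJ w, Matrix.mul_assoc, ← Matrix.star_eq_conjTranspose, hUr w, Matrix.mul_one, StdForm.transpose_over]
  set a' : arch (↥(maximalRealSubfield L)) L (IsCMField.complexConj L) 3 ((StdForm.antidiagonal 3).over L) :=
    (archPiEquiv (↥(maximalRealSubfield L)) L (IsCMField.complexConj L) 3 ((StdForm.antidiagonal 3).over L) (IsCMField.complexConj_ne_one L)
      (UnitaryGroup.complexConj_smul_infinitePlace L)).symm (fun w => ⟨Unitary.toUnits ⟨(M w)ᵀ, hUT w⟩, hLT w⟩) with ha'_def
  have ha' : ∀ w : {w : InfinitePlace L // w.IsComplex},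
      ((a' : GL (Fin 3) (mixedEmbedding.mixedSpace L)) : Matrix (Fin 3) (Fin 3) (mixedEmbedding.mixedSpace L)).map (evalC L w) = (M w)ᵀ := fun w => by
    ext i j
    rw [Matrix.map_apply, evalC_apply, ha'_def, coe_archPiEquiv_symm_apply]
    rfl
  refine ⟨⟨archToAdelic (↥(maximalRealSubfield L)) L (IsCMField.complexConj L) 3 ((StdForm.antidiagonal 3).over L) a',
    archToAdelic_mem_archMaximalCompact_of_forall_mem_unitaryGroup L a' fun w => by rw [ha' w]; exact hUT w⟩, fun w => ?_⟩
  change (((archPart (↥(maximalRealSubfield L)) L (IsCMField.complexConj L) 3 ((StdForm.antidiagonal 3).over L)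
      (archToAdelic (↥(maximalRealSubfield L)) L (IsCMField.complexConj L) 3 ((StdForm.antidiagonal 3).over L) a') :
      arch (↥(maximalRealSubfield L)) L (IsCMField.complexConj L) 3 ((StdForm.antidiagonal 3).over L)) : GL (Fin 3) (mixedEmbedding.mixedSpace L)) :
      Matrix (Fin 3) (Fin 3) (mixedEmbedding.mixedSpace L)).map (evalC L w) = (M w)ᵀ
  rw [archPart_archToAdelic]
  exact ha' w

/-! ## §3 Compactness of `K_∞` and `M_∞` -/

/-- **`ι(K_∞)` IS COMPACT**: it is the image under the continuous `ι` (★ `continuous_archToAdelic`) of `U(J₃)(L ⊗ ℝ) ∩ K_∞^{GL}`, the preimage of the compact ★ `Kinf` (★ `isCompact_Kinf_holds`) under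
the closed embedding `U(J₃)(L ⊗ ℝ) ↪ GL₃(L ⊗ ℝ)` (★ `isClosed_arch`). [cite: BorelJacquet1979, §1.1, §4.1] -/
theorem isCompact_archMaximalCompact : IsCompact ((archMaximalCompact L : Set (quasiSplit (↥(maximalRealSubfield L)) L (IsCMField.complexConj L) 3).Adelic)) := by
  have h1 : (archMaximalCompact L : Set (quasiSplit (↥(maximalRealSubfield L)) L (IsCMField.complexConj L) 3).Adelic) =
      archToAdelic (↥(maximalRealSubfield L)) L (IsCMField.complexConj L) 3 ((StdForm.antidiagonal 3).over L) ''
        {a : arch (↥(maximalRealSubfield L)) L (IsCMField.complexConj L) 3 ((StdForm.antidiagonal 3).over L) | (a : GL (Fin 3) (mixedEmbedding.mixedSpace L)) ∈ Kinf 3 L} := by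
    ext k
    constructor
    · rintro ⟨hk, a, rfl⟩
      refine ⟨a, ?_, rfl⟩
      have h := toMixed_mem_Kinf_of_mem_standardMaximalCompactGL hk
      rwa [adelicVal_archToAdelic, GLn.toMixed_ofInfinite] at h
    · rintro ⟨a, ha, rfl⟩
      refine archToAdelic_mem_archMaximalCompact L a ?_
      rw [adelicVal_archToAdelic]
      exact map_Kinf_le_standardMaximalCompactGL (Subgroup.mem_map_of_mem _ ha)
  rw [h1]
  refine IsCompact.image ?_ (continuous_archToAdelic _ _ _ _ _)
  exact (isClosed_arch (↥(maximalRealSubfield L)) L (IsCMField.complexConj L) 3 ((StdForm.antidiagonal 3).over L)).isClosedEmbedding_subtypeVal.isCompact_preimage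
    (isCompact_Kinf_holds 3 L)

/-- **THE TORUS `M_∞ = ι(K_∞) ∩ B(𝔸)` IS COMPACT** (`B(𝔸)` is closed, ★ `isClosed_borelAdelic`). [cite: BorelJacquet1979, §4.1] -/
theorem isCompact_archMaximalCompact_inf_borelAdelic :
    IsCompact ((archMaximalCompact L ⊓ borelAdelic (↥(maximalRealSubfield L)) L (IsCMField.complexConj L) 3 :
      Subgroup (quasiSplit (↥(maximalRealSubfield L)) L (IsCMField.complexConj L) 3).Adelic) : Set (quasiSplit (↥(maximalRealSubfield L)) L (IsCMField.complexConj L) 3).Adelic) := by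
  rw [Subgroup.coe_inf]
  exact (isCompact_archMaximalCompact L).inter_right isClosed_borelAdelic

end ArchMaximalCompact

end Summit.HodgeConjecture.HodgeConjecture.R90.S8

end
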